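import Summits.Ventures.PercRepro.GZSwapB
import Summits.Ventures.PercRepro.ConnJoin

/-!
# `IsBot` of a 4-terminal gluing (Lemma 1 of the profile theorem, three marks)

The set form `not_conn_marks_iff_parts` of `ConnJoin` specialised to the marks `a b c` and the centre
`x`: the gluing is `bot` iff every part is `bot` on the marks and no two parts connect two different
marks to the centre.
-/

namespace PercRepro

namespace MultiGraph

variable {V E ι : Type*} {G : MultiGraph V E}

/-- A symmetric relation fails on all pairs of three distinct points iff it fails on the three
pairs `ab`, `ac`, `bc`. -/
theorem forall_pairs_three_iff {R : V → V → Prop} (hR : ∀ u v, R u v → R v u) {a b c : V}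
    (hab : a ≠ b) (hac : a ≠ c) (hbc : b ≠ c) :
    (∀ m ∈ ({a, b, c} : Set V), ∀ m' ∈ ({a, b, c} : Set V), m ≠ m' → ¬ R m m') ↔
      (¬ R a b ∧ ¬ R a c ∧ ¬ R b c) := by
  simp only [Set.mem_insert_iff, Set.mem_singleton_iff]
  constructor
  · intro h
    exact ⟨h a (Or.inl rfl) b (Or.inr (Or.inl rfl)) hab, h a (Or.inl rfl) c (Or.inr (Or.inr rfl)) hac,
      h b (Or.inr (Or.inl rfl)) c (Or.inr (Or.inr rfl)) hbc⟩
  · rintro ⟨h1, h2, h3⟩ m (rfl | rfl | rfl) m' (rfl | rfl | rfl) hne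
    · exact absurd rfl hne
    · exact h1
    · exact h2
    · exact fun h => h1 (hR _ _ h)
    · exact absurd rfl hne
    · exact h3
    · exact fun h => h2 (hR _ _ h)
    · exact fun h => h3 (hR _ _ h)
    · exact absurd rfl hne

/-- **Lemma 1 (bot of a gluing) for three marks.** With terminals `{a, b, c, x}` (marks pairwise
distinct and different from the centre `x`) and every edge at a non-terminal inside that vertex's
part: `IsBot` of the gluing iff every part is `bot` on the marks and no two parts connect two
different marks to `x`. -/
theorem isBot_iff_parts (S : Config E) (Cen : Set V) (a b c x : V) (pe : E → ι) (br : V → ι)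
    (hpart : ∀ e, (G.fst e ∉ Cen → pe e = br (G.fst e)) ∧ (G.snd e ∉ Cen → pe e = br (G.snd e)))
    (ha : a ∈ Cen) (hb : b ∈ Cen) (hc : c ∈ Cen) (hx : x ∈ Cen)
    (hCen : ∀ t ∈ Cen, t = a ∨ t = b ∨ t = c ∨ t = x)
    (hab : a ≠ b) (hac : a ≠ c) (hbc : b ≠ c) (hxa : x ≠ a) (hxb : x ≠ b) (hxc : x ≠ c) :
    G.IsBot S a b c ↔
      (∀ i, ¬ G.ConnIn S pe i a b ∧ ¬ G.ConnIn S pe i a c ∧ ¬ G.ConnIn S pe i b c) ∧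
        (∀ i j, ¬ (G.ConnIn S pe i a x ∧ G.ConnIn S pe j b x) ∧
          ¬ (G.ConnIn S pe i a x ∧ G.ConnIn S pe j c x) ∧
          ¬ (G.ConnIn S pe i b x ∧ G.ConnIn S pe j c x)) := by
  have hMk : ({a, b, c} : Set V) ⊆ Cen := by
    intro t ht
    simp only [Set.mem_insert_iff, Set.mem_singleton_iff] at ht
    rcases ht with rfl | rfl | rfl
    · exact ha
    · exact hb
    · exact hc
  have hxM : x ∉ ({a, b, c} : Set V) := by
    simp only [Set.mem_insert_iff, Set.mem_singleton_iff, not_or]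
    exact ⟨hxa, hxb, hxc⟩
  have hCen' : ∀ t ∈ Cen, t ∈ ({a, b, c} : Set V) ∨ t = x := by
    intro t ht
    simp only [Set.mem_insert_iff, Set.mem_singleton_iff]
    rcases hCen t ht with h | h | h | h
    · exact Or.inl (Or.inl h)
    · exact Or.inl (Or.inr (Or.inl h))
    · exact Or.inl (Or.inr (Or.inr h))
    · exact Or.inr h
  have key := G.not_conn_marks_iff_parts S Cen {a, b, c} x pe br hpart hMk hx hxM hCen'
  rw [forall_pairs_three_iff (fun _ _ h => Conn.symm h) hab hac hbc] at key
  unfold IsBot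
  rw [key]
  constructor
  · rintro ⟨hbot, hmode⟩
    refine ⟨fun i => (forall_pairs_three_iff (fun _ _ h => connIn_symm h) hab hac hbc).1 (hbot i),
      fun i j => ⟨?_, ?_, ?_⟩⟩
    · rintro ⟨h1, h2⟩
      exact hmode i j a (by simp) b (by simp) hab h1 h2
    · rintro ⟨h1, h2⟩
      exact hmode i j a (by simp) c (by simp) hac h1 h2
    · rintro ⟨h1, h2⟩
      exact hmode i j b (by simp) c (by simp) hbc h1 h2
  · rintro ⟨hbot, hmode⟩
    refine ⟨fun i => (forall_pairs_three_iff (fun _ _ h => connIn_symm h) hab hac hbc).2 (hbot i), ?_⟩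
    intro i j m hm m' hm' hne h1 h2
    simp only [Set.mem_insert_iff, Set.mem_singleton_iff] at hm hm'
    rcases hm with rfl | rfl | rfl <;> rcases hm' with rfl | rfl | rfl
    · exact hne rfl
    · exact (hmode i j).1 ⟨h1, h2⟩
    · exact (hmode i j).2.1 ⟨h1, h2⟩
    · exact (hmode j i).1 ⟨h2, h1⟩
    · exact hne rfl
    · exact (hmode i j).2.2 ⟨h1, h2⟩
    · exact (hmode j i).2.1 ⟨h2, h1⟩
    · exact (hmode j i).2.2 ⟨h2, h1⟩
    · exact hne rfl

end MultiGraph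

end PercRepro
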